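import Mathlib
import HarnessLib
import Literature.Probability.MarkovChains.MetropolisHastings
import Literature.Probability.MarkovChains.TotalVariation

/-!
# Jarzynski's equality on a finite chain: non-equilibrium MCMC / stochastic normalizing flows are exact

HONEST FRAMING: exact (Metropolis-corrected) sampling algorithms for lattice gauge theory;
figures of merit are autocorrelation/cost numbers at stated couplings and volumes; no
continuum-physics claim.

Venture `LatticeQCDFlow` (cell pub-lqcd), topic `Exactness`, FANOUT row 30 (lean-1), statement
E4 of HOME/VENTURE-STATEMENT.md (v0 signature `JarzynskiFinite` of HOME/lean/VentureSketch.lean,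
here over the tree's Markov-chain vocabulary `IsStationary` / `IsRowStochastic`).  NEW WORK of
the cell (an elementary finite-sum proof), not a published result: nothing here is cited as a
fact; printed counterparts (Jarzynski 1997; Crooks 1998; Neal 2001 "annealed importance
sampling"; Caselle et al. 2016 arXiv:1604.05544 §2; Bonanno et al. arXiv:2510.25704 §2) are named
in docstrings only.

## Content

A PROTOCOL is a sequence of actions `S 0, …, S n : X → ℝ` on a finite configuration space and
Markov kernels `P 0, …, P (n-1)`, `P k` leaving the Boltzmann weight `exp (-S (k+1))` invariant
(`IsStationary`).  The non-equilibrium chain starts from `exp (-S 0)/Z 0`, and at step `k` first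
switches the action `S k → S (k+1)` at fixed configuration — paying the WORK increment
`S (k+1) x_k - S k x_k` — then moves `x_k → x_{k+1}` with `P k`.  Along a path
`x : Fin (n+1) → X` the total work is `work S x = Σ_k (S (k+1) (x k) - S k (x k))`.

* `jarzynski_observable` (the master identity, Crooks form):
  `Σ_paths e^{-S 0 (x 0)} · Π_k P k (x k) (x (k+1)) · e^{-W} · f (x n) = Σ_y e^{-S n y} f y`
  for every `f`; only the stationarity of each `P k` is used (no reversibility, no ergodicity,
  no normalisation of the kernels);
* `jarzynski` (E4): `E[e^{-W}] = Z n / Z 0` for the chain started in equilibrium at `S 0`;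
* `jarzynski_reweighting` (E4′, population form of the NE-MCMC estimator):
  `E[e^{-W} f(X n)] = (Z n / Z 0) · ⟨f⟩_{S n}`, so `⟨f⟩_{S n} = E[e^{-W} f(X n)] / E[e^{-W}]`
  EXACTLY — the reweighted estimator targets the right law whatever the protocol, the kernels'
  mixing or the number of steps (their quality only enters the variance / ESS);
* `sum_pathLaw` (the path weights are a probability law when the kernels are stochastic) and
  `freeEnergy_le_work` (Jensen: `⟨W⟩ ≥ F n - F 0 = -log (Z n / Z 0)`, the second law; the gap
  `⟨W⟩ - ΔF` is the forward/reverse path KL that stochastic-normalizing-flow training minimises).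

Dictionary: `X` = a finite discretisation of the gauge-field configuration space, `S k` =
interpolating lattice actions (e.g. in `β` or in a defect/boundary coupling), `P k` = any exact
update for `S (k+1)` (heat bath, over-relaxation, HMC, or a Metropolis-corrected flow layer as in
`FlowMCMC.lean`); deterministic flow layers between the stochastic ones (stochastic normalizing
flows) add their log-Jacobian to `W` — that is the change-of-variables file `FlowPushforward.lean`,
not this one.  The general-state-space version over `ProbabilityTheory.Kernel` is not here.
-/

namespace Summit.Ventures.LatticeQCDFlow.Exactness

open Finset
open Literature.Probability.MarkovChains

variable {X : Type*} [Fintype X]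

/-! ## Protocol objects -/

/-- Partition function `Z = Σ_x e^{-S x}` of an action on a finite configuration space. -/
noncomputable def partitionFn (S : X → ℝ) : ℝ := ∑ x, Real.exp (-S x)

/-- The Gibbs (Boltzmann) law `e^{-S x} / Z` of an action `S`. -/
noncomputable def gibbsLaw (S : X → ℝ) (x : X) : ℝ := Real.exp (-S x) / partitionFn S

/-- The WORK along a path `x 0, …, x n` under the protocol `S 0, …, S n`:
`W = Σ_{k<n} (S (k+1) (x k) - S k (x k))` (the action is switched before the `k`-th move). -/
noncomputable def work {n : ℕ} (S : Fin (n + 1) → X → ℝ) (x : Fin (n + 1) → X) : ℝ :=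
  ∑ k : Fin n, (S k.succ (x k.castSucc) - S k.castSucc (x k.castSucc))

/-- Product of the transition probabilities along a path: `Π_{k<n} P k (x k) (x (k+1))`. -/
noncomputable def transProb {n : ℕ} (P : Fin n → X → X → ℝ) (x : Fin (n + 1) → X) : ℝ :=
  ∏ k : Fin n, P k (x k.castSucc) (x k.succ)

/-- The law of the path `(X 0, …, X n)` of the (time-inhomogeneous) Markov chain with initial
law `μ₀` and kernels `P 0, …, P (n-1)`. -/
noncomputable def pathLaw {n : ℕ} (μ₀ : X → ℝ) (P : Fin n → X → X → ℝ) (x : Fin (n + 1) → X) :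
    ℝ :=
  μ₀ (x 0) * transProb P x

omit [Fintype X] in
/-- Peeling the first step off the transition product. -/
theorem transProb_cons {n : ℕ} (P : Fin (n + 1) → X → X → ℝ) (x₀ : X) (x : Fin (n + 1) → X) :
    transProb P (Fin.cons x₀ x : Fin (n + 2) → X) =
      P 0 x₀ (x 0) * transProb (fun k => P k.succ) x := by
  unfold transProb
  rw [Fin.prod_univ_succ]
  simp only [Fin.castSucc_zero, Fin.cons_zero, Fin.cons_succ, Fin.castSucc_succ]

omit [Fintype X] in
/-- Peeling the first step off the work. -/
theorem work_cons {n : ℕ} (S : Fin (n + 2) → X → ℝ) (x₀ : X) (x : Fin (n + 1) → X) :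
    work S (Fin.cons x₀ x : Fin (n + 2) → X) =
      (S 1 x₀ - S 0 x₀) + work (fun k => S k.succ) x := by
  unfold work
  rw [Fin.sum_univ_succ]
  simp only [Fin.castSucc_zero, Fin.cons_zero, Fin.cons_succ, Fin.castSucc_succ,
    Fin.succ_zero_eq_one]

/-- Fubini for paths: sum over the first configuration, then over the rest of the path. -/
theorem sum_path_cons {n : ℕ} (F : (Fin (n + 2) → X) → ℝ) :
    ∑ x : Fin (n + 2) → X, F x = ∑ x₀ : X, ∑ x : Fin (n + 1) → X, F (Fin.cons x₀ x) := by
  rw [← (Fin.consEquiv fun _ : Fin (n + 2) => X).sum_comp, Fintype.sum_prod_type]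
  rfl

/-- Paths of length one are single configurations. -/
theorem sum_path_zero (F : (Fin 1 → X) → ℝ) :
    ∑ x : Fin 1 → X, F x = ∑ x₀ : X, F (fun _ => x₀) := by
  refine Fintype.sum_equiv (Equiv.funUnique (Fin 1) X) _ _ fun x => ?_
  congr 1
  funext i
  rw [Equiv.funUnique_apply, Fin.default_eq_zero, Subsingleton.elim i 0]

/-! ## The path law is a probability law -/

/-- If the initial weights have total mass `m` and every kernel has unit row sums, the path
weights have total mass `m` (the marginal at time `0` is `μ₀`). -/
theorem sum_pathLaw : ∀ {n : ℕ} (μ₀ : X → ℝ) (P : Fin n → X → X → ℝ),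
    (∀ k x, ∑ y, P k x y = 1) → ∑ x : Fin (n + 1) → X, pathLaw μ₀ P x = ∑ x₀, μ₀ x₀
  | 0, μ₀, P, _ => by
    rw [sum_path_zero]
    refine sum_congr rfl fun x₀ _ => ?_
    simp [pathLaw, transProb]
  | n + 1, μ₀, P, hP => by
    rw [sum_path_cons]
    refine sum_congr rfl fun x₀ _ => ?_
    have ih := sum_pathLaw (n := n) (P 0 x₀) (fun k => P k.succ) fun k x => hP k.succ x
    calc ∑ x : Fin (n + 1) → X, pathLaw μ₀ P (Fin.cons x₀ x)
          = μ₀ x₀ * ∑ x : Fin (n + 1) → X, pathLaw (P 0 x₀) (fun k => P k.succ) x := by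
            rw [mul_sum]
            refine sum_congr rfl fun x _ => ?_
            simp only [pathLaw, transProb_cons, Fin.cons_zero]
      _ = μ₀ x₀ := by rw [ih, hP 0 x₀, mul_one]

/-- In particular the path law of a chain started from a probability vector and driven by
stochastic matrices is a probability law on paths (non-negative, total mass one). -/
theorem pathLaw_nonneg_sum_eq_one {n : ℕ} {μ₀ : X → ℝ} {P : Fin n → X → X → ℝ}
    (hμ : ∀ x, 0 ≤ μ₀ x) (hμ1 : ∑ x, μ₀ x = 1) (hP : ∀ k, IsRowStochastic (P k)) :
    (∀ x, 0 ≤ pathLaw μ₀ P x) ∧ ∑ x : Fin (n + 1) → X, pathLaw μ₀ P x = 1 :=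
  ⟨fun x => mul_nonneg (hμ _) (prod_nonneg fun k _ => (hP k).1 _ _),
    by rw [sum_pathLaw μ₀ P fun k => (hP k).2, hμ1]⟩

/-! ## Jarzynski's equality -/

/-- **Master identity (Crooks form).**  For a protocol `S 0, …, S n` and kernels `P k` leaving
`e^{-S (k+1)}` invariant, and every function `f` of the final configuration:
`Σ_paths e^{-S 0 (x 0)} · Π_k P k (x k) (x (k+1)) · e^{-W(x)} · f (x n) = Σ_y e^{-S n y} · f y`.
Proof: peel the first step; `e^{-S 0 x₀} e^{-(S 1 x₀ - S 0 x₀)} = e^{-S 1 x₀}` telescopes and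
`Σ_{x₀} e^{-S 1 x₀} P 0 x₀ x₁ = e^{-S 1 x₁}` is stationarity; induct.  Only stationarity of each
kernel is used. -/
theorem jarzynski_observable : ∀ {n : ℕ} (S : Fin (n + 1) → X → ℝ) (P : Fin n → X → X → ℝ),
    (∀ k : Fin n, IsStationary (fun x => Real.exp (-S k.succ x)) (P k)) → ∀ f : X → ℝ,
    ∑ x : Fin (n + 1) → X,
        Real.exp (-S 0 (x 0)) * transProb P x * Real.exp (-work S x) * f (x (Fin.last n)) =
      ∑ y, Real.exp (-S (Fin.last n) y) * f y
  | 0, S, P, _, f => by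
    rw [sum_path_zero]
    refine sum_congr rfl fun x₀ _ => ?_
    simp [transProb, work]
  | n + 1, S, P, hP, f => by
    have ih := jarzynski_observable (n := n) (fun k => S k.succ) (fun k => P k.succ)
      (fun k => hP k.succ) f
    rw [sum_path_cons]
    -- the summand, after peeling the first step
    have hsummand : ∀ (x₀ : X) (x : Fin (n + 1) → X),
        Real.exp (-S 0 ((Fin.cons x₀ x : Fin (n + 2) → X) 0)) *
            transProb P (Fin.cons x₀ x : Fin (n + 2) → X) *
            Real.exp (-work S (Fin.cons x₀ x : Fin (n + 2) → X)) *
            f ((Fin.cons x₀ x : Fin (n + 2) → X) (Fin.last (n + 1))) =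
          (Real.exp (-S 1 x₀) * P 0 x₀ (x 0)) *
            (transProb (fun k => P k.succ) x * Real.exp (-work (fun k => S k.succ) x) *
              f (x (Fin.last n))) := by
      intro x₀ x
      rw [Fin.cons_zero, transProb_cons, work_cons, ← Fin.succ_last, Fin.cons_succ]
      have hexp : Real.exp (-S 0 x₀) * Real.exp (-(S 1 x₀ - S 0 x₀ + work (fun k => S k.succ) x))
          = Real.exp (-S 1 x₀) * Real.exp (-work (fun k => S k.succ) x) := by
        rw [← Real.exp_add, ← Real.exp_add]
        congr 1
        ring
      calc Real.exp (-S 0 x₀) * (P 0 x₀ (x 0) * transProb (fun k => P k.succ) x) *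
              Real.exp (-(S 1 x₀ - S 0 x₀ + work (fun k => S k.succ) x)) * f (x (Fin.last n))
            = (Real.exp (-S 0 x₀) *
                Real.exp (-(S 1 x₀ - S 0 x₀ + work (fun k => S k.succ) x))) *
                (P 0 x₀ (x 0) * transProb (fun k => P k.succ) x) * f (x (Fin.last n)) := by
              ring
        _ = _ := by rw [hexp]; ring
    simp_rw [hsummand]
    rw [sum_comm]
    calc ∑ x : Fin (n + 1) → X, ∑ x₀, (Real.exp (-S 1 x₀) * P 0 x₀ (x 0)) *
            (transProb (fun k => P k.succ) x * Real.exp (-work (fun k => S k.succ) x) *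
              f (x (Fin.last n)))
          = ∑ x : Fin (n + 1) → X, Real.exp (-S 1 (x 0)) *
              (transProb (fun k => P k.succ) x * Real.exp (-work (fun k => S k.succ) x) *
                f (x (Fin.last n))) := by
            refine sum_congr rfl fun x _ => ?_
            rw [← sum_mul]
            congr 1
            exact hP 0 (x 0)
      _ = ∑ y, Real.exp (-S (Fin.last (n + 1)) y) * f y := by
            simp only [Fin.succ_last, Fin.succ_zero_eq_one] at ih
            rw [← ih]
            refine sum_congr rfl fun x _ => ?_
            ring

/-- **E4 — Jarzynski's equality (finite chain, finite configuration space).**  Started in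
equilibrium at `S 0` (law `e^{-S 0}/Z 0`) and driven through kernels `P k` that leave
`e^{-S (k+1)}` invariant, the path average of `e^{-W}` is EXACTLY the ratio of partition
functions: `Σ_paths (e^{-S 0 (x 0)}/Z 0) · Π_k P k (x k) (x (k+1)) · e^{-W(x)} = Z n / Z 0`
(Jarzynski 1997; the identity behind every NE-MCMC / stochastic-normalizing-flow `reweight`
estimator, Caselle et al. 2016, Bonanno et al. 2024–2026).  No assumption on how fast the `P k`
mix, nor on `n`. -/
theorem jarzynski {n : ℕ} (S : Fin (n + 1) → X → ℝ) (P : Fin n → X → X → ℝ)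
    (hP : ∀ k : Fin n, IsStationary (fun x => Real.exp (-S k.succ x)) (P k)) :
    ∑ x : Fin (n + 1) → X, pathLaw (gibbsLaw (S 0)) P x * Real.exp (-work S x) =
      partitionFn (S (Fin.last n)) / partitionFn (S 0) := by
  have h := jarzynski_observable S P hP fun _ => 1
  simp only [mul_one] at h
  rw [partitionFn, ← h, sum_div]
  refine sum_congr rfl fun x _ => ?_
  simp only [pathLaw, gibbsLaw, partitionFn]
  ring

/-- **E4′ — exactness of NE-MCMC reweighting (population form).**  For every observable `f` of
the final configuration, `E[e^{-W} · f(X n)] = (Z n / Z 0) · ⟨f⟩_{S n}` where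
`⟨f⟩_{S n} = Σ_y f y e^{-S n y} / Z n` is the TARGET expectation.  With `jarzynski` this says
`⟨f⟩_{S n} = E[e^{-W} f(X n)] / E[e^{-W}]`: the reweighted non-equilibrium estimator is consistent
for the target law for ANY protocol and ANY invariant kernels (their quality only enters the
variance, i.e. the ESS of the weights `e^{-W}`); the finite-sample ratio estimator is consistent,
not unbiased. -/
theorem jarzynski_reweighting {n : ℕ} [Nonempty X] (S : Fin (n + 1) → X → ℝ)
    (P : Fin n → X → X → ℝ)
    (hP : ∀ k : Fin n, IsStationary (fun x => Real.exp (-S k.succ x)) (P k)) (f : X → ℝ) :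
    ∑ x : Fin (n + 1) → X, pathLaw (gibbsLaw (S 0)) P x * Real.exp (-work S x) * f (x (Fin.last n))
      = partitionFn (S (Fin.last n)) / partitionFn (S 0) *
          ∑ y, gibbsLaw (S (Fin.last n)) y * f y := by
  have hZ : partitionFn (S (Fin.last n)) ≠ 0 :=
    (sum_pos (fun y _ => Real.exp_pos _) univ_nonempty).ne'
  · have h := jarzynski_observable S P hP f
    calc ∑ x : Fin (n + 1) → X,
          pathLaw (gibbsLaw (S 0)) P x * Real.exp (-work S x) * f (x (Fin.last n))
          = (∑ x : Fin (n + 1) → X,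
              Real.exp (-S 0 (x 0)) * transProb P x * Real.exp (-work S x) * f (x (Fin.last n))) /
              partitionFn (S 0) := by
            rw [sum_div]
            refine sum_congr rfl fun x _ => ?_
            simp only [pathLaw, gibbsLaw]
            ring
      _ = (∑ y, Real.exp (-S (Fin.last n) y) * f y) / partitionFn (S 0) := by rw [h]
      _ = partitionFn (S (Fin.last n)) / partitionFn (S 0) *
            ∑ y, gibbsLaw (S (Fin.last n)) y * f y := by
            simp only [gibbsLaw]
            rw [mul_sum, sum_div]
            refine sum_congr rfl fun y _ => ?_
            field_simp

/-! ## The second law: dissipated work is non-negative on average -/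

/-- Free energy `F = -log Z` of an action. -/
noncomputable def freeEnergy (S : X → ℝ) : ℝ := -Real.log (partitionFn S)

/-- **Second law / annealed-importance-sampling bound.**  For stochastic kernels leaving the
intermediate Boltzmann weights invariant, the mean work is at least the free-energy difference:
`F n - F 0 ≤ E[W]` (Jensen applied to `jarzynski`: `e^{-E W} ≤ E e^{-W} = Z n / Z 0`).  The slack
`E[W] - ΔF ≥ 0` is the dissipated work `= D_KL(forward paths ‖ reverse paths)`, the training
objective of stochastic normalizing flows; it vanishes only for a quasi-static (or perfectly
trivializing) protocol. -/
theorem freeEnergy_le_work {n : ℕ} [Nonempty X] (S : Fin (n + 1) → X → ℝ)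
    (P : Fin n → X → X → ℝ) (hP : ∀ k, IsRowStochastic (P k))
    (hS : ∀ k : Fin n, IsStationary (fun x => Real.exp (-S k.succ x)) (P k)) :
    freeEnergy (S (Fin.last n)) - freeEnergy (S 0) ≤
      ∑ x : Fin (n + 1) → X, pathLaw (gibbsLaw (S 0)) P x * work S x := by
  have hZpos : ∀ T : X → ℝ, 0 < partitionFn T := fun T =>
    sum_pos (fun y _ => Real.exp_pos _) univ_nonempty
  have hg : ∀ x, 0 ≤ gibbsLaw (S 0) x := fun x =>
    div_nonneg (Real.exp_pos _).le (hZpos _).le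
  have hg1 : ∑ x, gibbsLaw (S 0) x = 1 := by
    simp only [gibbsLaw]
    rw [← sum_div, ← partitionFn, div_self (hZpos _).ne']
  obtain ⟨hnn, hsum⟩ := pathLaw_nonneg_sum_eq_one (P := P) hg hg1 hP
  -- Jensen for the convex function `exp ∘ neg`
  have hj := (convexOn_exp.comp_linearMap (-LinearMap.id : ℝ →ₗ[ℝ] ℝ)).map_sum_le
    (t := univ) (w := fun x : Fin (n + 1) → X => pathLaw (gibbsLaw (S 0)) P x)
    (p := fun x => work S x) (fun x _ => hnn x) hsum (fun x _ => Set.mem_univ _)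
  simp only [Function.comp, LinearMap.neg_apply, LinearMap.id_apply, smul_eq_mul] at hj
  rw [jarzynski S P hS] at hj
  -- take logarithms
  have hlog := Real.log_le_log (Real.exp_pos _) hj
  rw [Real.log_exp, Real.log_div (hZpos _).ne' (hZpos _).ne'] at hlog
  unfold freeEnergy
  linarith

end Summit.Ventures.LatticeQCDFlow.Exactness
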